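import Mathlib.Algebra.QuadraticAlgebra.Basic
import Mathlib.NumberTheory.NumberField.Basic
import Mathlib.NumberTheory.Cyclotomic.Basic
import Mathlib.FieldTheory.IsAlgClosed.AlgebraicClosure
import Mathlib.RingTheory.RootsOfUnity.PrimitiveRoots
import HarnessLib

/-!
# The Eisenstein field `ℚ(ζ₃) = ℚ(√−3)` as a quadratic algebra

Topic `NumberTheory/NumberFields`. A concrete model of the third cyclotomic field for the
`√−3`-descent on the cubic twists `y² = x³ + (2^a 5^b)²`
(`Literature/Barriers/BirchSwinnertonDyer/RankNotSumOfLocalInvariantsCubicTwists.lean`):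

* `K3 = ℚ[ω]/(ω² + ω + 1)`, Mathlib's `QuadraticAlgebra ℚ (-1) (-1)` (`ω² = -1 + (-1)ω`), a field
  (`ω² + ω + 1` has no rational root) and a number field of degree `2`; elements are `⟨a, b⟩ = a + bζ`
  with `ζ = ω`, so that COORDINATES are available for explicit local computations;
* `K3.zeta = ζ` is a primitive cube root of unity (`isPrimitiveRoot_zeta`), `K3.theta = 2ζ + 1 = √−3`
  (`theta_sq`), `K3.lam = 1 − ζ` (`lam_sq : λ² = −3ζ`), and `K3` is the third cyclotomic field
  (`instance : IsCyclotomicExtension {3} ℚ K3`), so that Mathlib's arithmetic of `ℚ(ζ₃)` (class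
  number one `IsCyclotomicExtension.Rat.three_pid`, units `±ζ^k`) applies to `𝓞 K3`;
* the conjugation `K3.conj` (`ζ ↦ ζ² = ζ̄`, Mathlib's star structure) and an extension `K3.conjBar`
  to an automorphism of the algebraic closure with `conjBar θ̄ = −θ̄` (`IsAlgClosure.equivOfEquiv`),
  the input `σ` of `Literature.NumberTheory.EllipticCurves.SqrtThree.sqrtThree_comp_self`.

All [folklore].

## References

* K. Ireland, M. Rosen, *A Classical Introduction to Modern Number Theory*, 2nd ed., GTM 84
  (1990), Ch. 9 §1 (the ring `ℤ[ω]`, `λ = 1 − ω`, `3 = −ω²λ²`). [IrelandRosen1990]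
-/

noncomputable section

open QuadraticAlgebra

namespace Literature.NumberTheory.NumberFields

/-- **The Eisenstein field `ℚ(ζ₃)`** as the quadratic algebra `ℚ[ω]/(ω² + ω + 1)`:
elements `⟨a, b⟩ = a + b ζ`. [folklore] -/
abbrev K3 : Type := QuadraticAlgebra ℚ (-1) (-1)

namespace K3

/-- `ω² + ω + 1 = 0` has no rational solution, so `K3` is a field. [folklore] -/
instance instFact : Fact (∀ r : ℚ, r ^ 2 ≠ (-1 : ℚ) + (-1) * r) :=
  ⟨fun r h ↦ by nlinarith [sq_nonneg (2 * r + 1)]⟩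

/-- Coordinates of a rational number. [folklore] -/
@[simp] theorem ratCast_re (q : ℚ) : (q : K3).re = q := rfl
/-- Coordinates of a rational number. [folklore] -/
@[simp] theorem ratCast_im (q : ℚ) : (q : K3).im = 0 := rfl

/-- `K3` is a number field (degree `2`). [folklore] -/
instance instNumberField : NumberField K3 := NumberField.mk

/-- `[K3 : ℚ] = 2`. [folklore] -/
theorem finrank_eq : Module.finrank ℚ K3 = 2 := finrank_eq_two _ _

/-- The cube root of unity `ζ = ω = ⟨0, 1⟩`. [folklore] -/
def zeta : K3 := ω

/-- `ζ = ⟨0, 1⟩`. [folklore] -/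
theorem zeta_eq : zeta = ⟨0, 1⟩ := rfl
/-- Coordinates of `ζ`. [folklore] -/
@[simp] theorem zeta_re : zeta.re = 0 := rfl
/-- Coordinates of `ζ`. [folklore] -/
@[simp] theorem zeta_im : zeta.im = 1 := rfl

/-- Every element is `a + b ζ`. [folklore] -/
theorem eq_re_add_im_zeta (x : K3) : x = (x.re : K3) + (x.im : K3) * zeta := by
  ext <;> simp [zeta]

/-- `⟨a, b⟩ = a + bζ`. [folklore] -/
theorem mk_eq (a b : ℚ) : (⟨a, b⟩ : K3) = (a : K3) + (b : K3) * zeta := by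
  ext <;> simp [zeta]

/-- `ζ² = −1 − ζ`. [folklore] -/
theorem zeta_sq : zeta ^ 2 = -1 - zeta := by
  ext <;> simp [zeta, sq]

/-- `ζ³ = 1`. [folklore] -/
theorem zeta_pow_three : zeta ^ 3 = 1 := by
  calc zeta ^ 3 = zeta * zeta ^ 2 := by ring
    _ = 1 := by rw [zeta_sq]; ext <;> simp [zeta]

/-- `ζ ≠ 1`. [folklore] -/
theorem zeta_ne_one : zeta ≠ 1 := fun h ↦ by
  have := congrArg QuadraticAlgebra.im h
  simp [zeta] at this

/-- **`ζ` is a primitive cube root of unity.** [folklore] -/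
theorem isPrimitiveRoot_zeta : IsPrimitiveRoot zeta 3 := by
  refine IsPrimitiveRoot.mk_of_lt zeta (by norm_num) zeta_pow_three fun i hi0 hi3 hi ↦ ?_
  interval_cases i
  · rw [pow_one] at hi; exact zeta_ne_one hi
  · have h : zeta ^ 3 = zeta := by rw [pow_succ, hi, one_mul]
    rw [zeta_pow_three] at h
    exact zeta_ne_one h.symm

/-- **`K3` is the third cyclotomic field over `ℚ`.** [folklore] -/
instance instIsCyclotomicExtension : IsCyclotomicExtension {3} ℚ K3 := by
  rw [IsCyclotomicExtension.iff_singleton]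
  refine ⟨⟨zeta, isPrimitiveRoot_zeta⟩, fun x ↦ ?_⟩
  rw [eq_re_add_im_zeta x]
  refine Subalgebra.add_mem _ (Subalgebra.algebraMap_mem _ x.re) (Subalgebra.mul_mem _
    (Subalgebra.algebraMap_mem _ x.im) (Algebra.subset_adjoin ?_))
  exact zeta_pow_three

/-- `θ = 2ζ + 1 = √−3`. [folklore] -/
def theta : K3 := 2 * zeta + 1

/-- Coordinates of `θ`. [folklore] -/
@[simp] theorem theta_re : theta.re = 1 := by simp [theta, zeta]
/-- Coordinates of `θ`. [folklore] -/
@[simp] theorem theta_im : theta.im = 2 := by simp [theta, zeta]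

/-- **`θ² = −3`.** [folklore] -/
theorem theta_sq : theta ^ 2 = -3 := by
  rw [theta, add_sq, mul_pow, zeta_sq]; ring

/-- `λ = 1 − ζ`, the prime above `3`. [folklore] -/
def lam : K3 := 1 - zeta

/-- Coordinates of `λ`. [folklore] -/
@[simp] theorem lam_re : lam.re = 1 := by simp [lam, zeta]
/-- Coordinates of `λ`. [folklore] -/
@[simp] theorem lam_im : lam.im = -1 := by simp [lam, zeta]

/-- `λ² = −3ζ` (so `(3) = (λ)²`). [cite: IrelandRosen1990, Ch. 9 §1] -/
theorem lam_sq : lam ^ 2 = -3 * zeta := by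
  rw [lam, sub_sq, zeta_sq]; ring

/-- `3 = −ζ² λ²`. [cite: IrelandRosen1990, Ch. 9 §1] -/
theorem three_eq : (3 : K3) = -(zeta ^ 2 * lam ^ 2) := by
  rw [lam_sq, show zeta ^ 2 * (-3 * zeta) = -3 * zeta ^ 3 by ring, zeta_pow_three]; ring

/-! ### The conjugation `ζ ↦ ζ²` and its extension to the algebraic closure -/

/-- **The conjugation** of `K3` (`ζ ↦ ζ̄ = ζ² = −1 − ζ`; Mathlib's star structure on a quadratic
algebra, `star ⟨a, b⟩ = ⟨a − b, −b⟩`). [folklore] -/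
def conj : K3 ≃+* K3 := starRingAut

/-- `conj x = star x`. [folklore] -/
theorem conj_apply (x : K3) : conj x = star x := rfl

/-- `conj θ = −θ`. [folklore] -/
theorem conj_theta : conj theta = -theta := by
  rw [conj_apply]; ext <;> simp [theta, zeta]; norm_num

/-- `conj` fixes the rationals. [folklore] -/
theorem conj_ratCast (q : ℚ) : conj (q : K3) = q := by
  rw [conj_apply]; ext <;> simp

/-- **An automorphism of `K̄3` extending the conjugation** (`IsAlgClosure.equivOfEquiv`).
[folklore] -/
def conjBar : AlgebraicClosure K3 ≃+* AlgebraicClosure K3 :=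
  IsAlgClosure.equivOfEquiv (AlgebraicClosure K3) (AlgebraicClosure K3) conj

/-- `conjBar` restricts to `conj`. [folklore] -/
theorem conjBar_algebraMap (x : K3) :
    conjBar (algebraMap K3 _ x) = algebraMap K3 _ (conj x) :=
  IsAlgClosure.equivOfEquiv_algebraMap _ _ conj x

/-- `conjBar θ̄ = −θ̄`. [folklore] -/
theorem conjBar_theta : conjBar (algebraMap K3 _ theta) = -algebraMap K3 _ theta := by
  rw [conjBar_algebraMap, conj_theta, map_neg]

/-- `conjBar` fixes the rationals of `K3`. [folklore] -/
theorem conjBar_ratCast (q : ℚ) : conjBar (algebraMap K3 _ (q : K3)) = algebraMap K3 _ (q : K3) := by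
  rw [conjBar_algebraMap, conj_ratCast]

end K3

end Literature.NumberTheory.NumberFields

end
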